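import Summits.CriticalPhenomena.Ising3DConformalLimit.Theorems.HyperoctahedralRPExistsScaleCovariantLimitFunnelDoublingIffAxisRate
import Literature.Probability.LatticeModels.CriticalAxisRatioRegularity
import Literature.Probability.LatticeModels.CriticalTwoPointBounds
import HarnessLib

/-!
# Line `folded-current-repulsion`, engine F2 (= item 6150): HEAVY scales double — the non-doubling scales are light

Lead `prover-line-stmt-CriticalPhenomena-1981-c15-0` (crux `ExistsScaleCovariantLimit`, stmt-CriticalPhenomena-1981), registered
sub-goal `heavyScale_doubling`. Write `g(n) = ⟨σ₀σ_{ne₀}⟩_{β_c(3)}` (`criticalTwoPoint 3 (Pi.single 0 n)`). Item 6150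
`TwoPointDoubling` asks for `κ g(n) ≤ g(2n)` at EVERY scale. Its birth line (crux dir `Cruxes/TwoPointDoubling`) splits the scales
by the Duminil-Copin–Panis threshold `g(k) ≶ A k^{-3/2}`; the all-LEAN windows were settled by `stub_leanScalePropagation`
(p142463). This file settles, by reflection positivity alone, the opposite end: the HEAVY scales, where the level
`θ(n) := n·g(n)` (which the infrared bound caps, `θ ≤ C`) is bounded below.

* `LogConvexSeq.level_lt_of_not_doubling` (real-variable core, any positive sequence `G` with nondecreasing shifted ratios
  and `j·G(j) ≤ C`): if `κ`-doubling FAILS at a scale `n ≥ 2` (`G(2n) < κ G(n)`, `0 < κ ≤ 1`) then `n·G(n) < 2C·κ^{1/4}`.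
  Mechanism: the first ratio `r = G(n+1)/G(n)` satisfies `rⁿ ≤ G(2n)/G(n) < κ` (ratios nondecreasing upward), and going
  DOWN from `n` to `j = ⌈n/2⌉` every ratio is `≤ r`, so `G(n) ≤ r^{n−j} G(j) < κ^{1/4}·C/j ≤ 2Cκ^{1/4}/n`.
* `heavyScale_doubling` (registered sub-goal): for every level `T > 0` there is `κ(T) > 0` with `κ g(n) ≤ g(2n)` at every
  `n ≥ 1` with `n·g(n) ≥ T` — explicitly `κ = min(g(2)/g(1), (T/2C)⁴)`.
* `not_doubling_level_lt`: the set of scales where `κ`-doubling fails lies inside `{n ≥ 2 : n·g(n) < 2Cκ^{1/4}}`.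

Reading for item 6150 (honest): together with the lean engine, the scales NOT covered are exactly the intermediate ones —
`n` light (`n g(n) < T`) with an `A`-fat scale `k ≤ 8n` below it (the crossover regime of the birth card). In the expected
world (`g(n) ≈ n^{-1-η}`, `η ≈ 0.036 > 0`) `θ(n) → 0`, so this lemma, like the lean one, does not bite where the truth lives;
it is RP-only (log-convexity `criticalTwoPoint_axis_ratio_mono` + the upper envelope of `criticalTwoPoint_bounds_holds`) and
serves to LOCALISE the open content of 6150: a non-doubling scale is a LIGHT scale sitting on an exponential episode
(`r_j < κ^{1/n}` for all `j ≤ n`).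

References: M. Aizenman, H. Duminil-Copin, Ann. Math. 194 (2021) = arXiv:1912.07973, Prop. 5.3 (5.17), §5.5, Remark 5.10;
J. Fröhlich, B. Simon, T. Spencer, CMP 50 (1976) (infrared bound); H. Duminil-Copin, R. Panis, arXiv:2404.05700, §1.
-/

noncomputable section

open Literature.Probability.LatticeModels Real
open Summit.CriticalPhenomena.Ising3DConformalLimit.Theses

namespace Summit.CriticalPhenomena.Ising3DConformalLimit.Cruxes.ExistsScaleCovariantLimit

namespace Funnel.LogConvexSeq

variable {G : ℕ → ℝ}

/-- **Real-variable core.** For a positive sequence with nondecreasing shifted ratios and level bound `j·G(j) ≤ C`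
(`j ≥ 1`): if `G(2n) < κ·G(n)` at some `n ≥ 2` with `0 < κ ≤ 1`, then `n·G(n) < 2C·κ^{1/4}`. [folklore] -/
theorem level_lt_of_not_doubling (hpos : ∀ n, 0 < G n) (hmono : Monotone fun k => G (k + 2) / G (k + 1))
    {C : ℝ} (henv : ∀ j : ℕ, 1 ≤ j → (j : ℝ) * G j ≤ C) {κ : ℝ} (hκ : 0 < κ) (hκ1 : κ ≤ 1)
    {n : ℕ} (hn : 2 ≤ n) (hfail : G (2 * n) < κ * G n) :
    (n : ℝ) * G n < 2 * C * κ ^ ((1 : ℝ) / 4) := by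
  have hn1 : 1 ≤ n := by omega
  -- the first ratio `r = G(n+1)/G(n)` and `rⁿ < κ`
  set r : ℝ := G (n - 1 + 2) / G (n - 1 + 1) with hr
  have hrpos : 0 < r := div_pos (hpos _) (hpos _)
  have hrn : r ^ n < κ := by
    have h1 : r ^ n * G n ≤ G (n + n) := pow_mul_le_add hpos hmono hn1 n
    have h2 : r ^ n * G n < κ * G n := by
      calc r ^ n * G n ≤ G (n + n) := h1
        _ = G (2 * n) := by rw [two_mul]
        _ < κ * G n := hfail
    exact lt_of_mul_lt_mul_right h2 (hpos n).le
  -- `j = ⌈n/2⌉`, `s = n - j` steps down from `n` to `j`, each ratio `≤ r`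
  set j : ℕ := (n + 1) / 2 with hj
  set s : ℕ := n - j with hs
  have hj1 : 1 ≤ j := by omega
  have h2j : 2 * j ≤ n - 1 + 2 := by omega
  have hsj : s ≤ j := by omega
  have hs1 : 1 ≤ s := by omega
  have h4s : n ≤ 4 * s := by omega
  have hn2j : n ≤ 2 * j := by omega
  have hstep : G n ≤ r ^ s * G j := by
    have h := add_le_pow_mul hpos hmono (n := j) (k := n - 1) h2j s hsj
    rwa [show j + s = n by omega] at h
  -- `r^s < κ^{1/4}`
  have hn0 : (0 : ℝ) < n := by exact_mod_cast (show 0 < n by omega)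
  have hrs : r ^ s < κ ^ ((1 : ℝ) / 4) := by
    have e1 : r ^ s = (r ^ n) ^ ((s : ℝ) / n) := by
      rw [← Real.rpow_natCast r n, ← Real.rpow_mul hrpos.le, ← Real.rpow_natCast r s]
      congr 1
      field_simp
    rw [e1]
    have hexp : 0 < (s : ℝ) / n := div_pos (by exact_mod_cast (show 0 < s by omega)) hn0
    calc (r ^ n) ^ ((s : ℝ) / n) < κ ^ ((s : ℝ) / n) :=
          Real.rpow_lt_rpow (pow_nonneg hrpos.le n) hrn hexp
      _ ≤ κ ^ ((1 : ℝ) / 4) := by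
          apply Real.rpow_le_rpow_of_exponent_ge hκ hκ1
          rw [div_le_div_iff₀ (by norm_num) hn0]
          have : (n : ℝ) ≤ 4 * (s : ℝ) := by exact_mod_cast h4s
          linarith
  -- assemble: `n G(n) ≤ n r^s G(j) < n κ^{1/4} G(j) ≤ 2 κ^{1/4} (j G(j)) ≤ 2 C κ^{1/4}`
  have hGj : 0 < G j := hpos j
  have hκ4 : 0 < κ ^ ((1 : ℝ) / 4) := Real.rpow_pos_of_pos hκ _
  have hjC : (j : ℝ) * G j ≤ C := henv j hj1
  have hnj : (n : ℝ) ≤ 2 * (j : ℝ) := by exact_mod_cast hn2j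
  calc (n : ℝ) * G n ≤ (n : ℝ) * (r ^ s * G j) := mul_le_mul_of_nonneg_left hstep hn0.le
    _ < (n : ℝ) * (κ ^ ((1 : ℝ) / 4) * G j) :=
        mul_lt_mul_of_pos_left (mul_lt_mul_of_pos_right hrs hGj) hn0
    _ ≤ (2 * (j : ℝ)) * (κ ^ ((1 : ℝ) / 4) * G j) :=
        mul_le_mul_of_nonneg_right hnj (mul_nonneg hκ4.le hGj.le)
    _ = 2 * ((j : ℝ) * G j) * κ ^ ((1 : ℝ) / 4) := by ring
    _ ≤ 2 * C * κ ^ ((1 : ℝ) / 4) := by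
        have := mul_le_mul_of_nonneg_left hjC (show (0 : ℝ) ≤ 2 by norm_num)
        exact mul_le_mul_of_nonneg_right this hκ4.le

end Funnel.LogConvexSeq

namespace FoldedCurrentRepulsion

/-- **Level envelope along the axis**: `n·⟨σ₀σ_{ne₀}⟩_{β_c(3)} ≤ C` for `n ≥ 1`, with `C > 0` (the infrared upper bound
`⟨σ₀σ_x⟩_{β_c} ≤ C‖x‖⁻¹` of `criticalTwoPoint_bounds_holds` at `x = n e₀`, `‖n e₀‖ = n`). [cite: DuminilCopin2019, Thm. 4.8, §4.4] -/
theorem axis_level_le : ∃ C : ℝ, 0 < C ∧ ∀ n : ℕ, 1 ≤ n → (n : ℝ) * criticalTwoPoint 3 (Pi.single 0 (n : ℤ)) ≤ C := by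
  obtain ⟨c, C, hc, hb⟩ := criticalTwoPoint_bounds_holds (d := 3) le_rfl
  have key : ∀ n : ℕ, 1 ≤ n → (n : ℝ) * criticalTwoPoint 3 (Pi.single 0 (n : ℤ)) ≤ C := by
    intro n hn
    have hnorm : ‖(Pi.single 0 (n : ℤ) : Site 3)‖ = (n : ℝ) := by
      rw [Pi.norm_single, Int.norm_natCast]
    have hn0 : (0 : ℝ) < n := by exact_mod_cast hn
    have hx : (Pi.single 0 (n : ℤ) : Site 3) ≠ 0 := by
      rw [← norm_pos_iff, hnorm]; exact hn0
    have hhi := (hb _ hx).2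
    rw [hnorm, show (-(((3 : ℕ) : ℝ) - 2)) = -1 by norm_num, Real.rpow_neg_one, ← div_eq_mul_inv,
      le_div_iff₀ hn0] at hhi
    linarith
  refine ⟨C, ?_, key⟩
  have h1 := key 1 le_rfl
  have hg1 : 0 < criticalTwoPoint 3 (Pi.single 0 ((1 : ℕ) : ℤ)) := Funnel.criticalTwoPoint_axis_pos 0 1
  simp only [Nat.cast_one, one_mul] at h1 hg1
  linarith

/-- **HEAVY SCALES DOUBLE** (registered sub-goal; F2 partial, RP-only). For every level `T > 0` there is `κ > 0` such that
`κ·g(n) ≤ g(2n)` at every scale `n ≥ 1` with `n·g(n) ≥ T`, `g(n) = ⟨σ₀σ_{ne₀}⟩_{β_c(3)}`; explicitly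
`κ = min(g(2)/g(1), (T/2C)⁴)` with `C` the level envelope. Complements the lean-window engine of item 6150's birth line: the
scales where doubling can fail are the LIGHT ones (`n·g(n) → 0` along them).
[cite: AizenmanDuminilCopinAnnals2021, arXiv:1912.07973 Prop. 5.3 (5.17), §5.5 and Remark 5.10 (p. 20)] -/
theorem heavyScale_doubling : ∀ T : ℝ, 0 < T → ∃ κ : ℝ, 0 < κ ∧ ∀ n : ℕ, 1 ≤ n →
      T ≤ (n : ℝ) * criticalTwoPoint 3 (Pi.single 0 (n : ℤ)) →
      κ * criticalTwoPoint 3 (Pi.single 0 (n : ℤ)) ≤ criticalTwoPoint 3 (Pi.single 0 (2 * (n : ℤ))) := by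
  intro T hT
  obtain ⟨C, hC, henv⟩ := axis_level_le
  have hpos : ∀ n : ℕ, 0 < criticalTwoPoint 3 (Pi.single 0 (n : ℤ)) := Funnel.criticalTwoPoint_axis_pos 0
  have hmono := criticalTwoPoint_axis_ratio_mono 0
  set g1 : ℝ := criticalTwoPoint 3 (Pi.single 0 ((1 : ℕ) : ℤ)) with hg1
  set g2 : ℝ := criticalTwoPoint 3 (Pi.single 0 ((2 : ℕ) : ℤ)) with hg2
  have hg1p : 0 < g1 := hpos 1
  have hg2p : 0 < g2 := hpos 2
  have h21 : g2 ≤ g1 := criticalTwoPoint_axis_succ_le 0 0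
  have hTC : 0 < T / (2 * C) := div_pos hT (by linarith)
  refine ⟨min (g2 / g1) ((T / (2 * C)) ^ 4), lt_min (div_pos hg2p hg1p) (by positivity), fun n hn hTn => ?_⟩
  set κ : ℝ := min (g2 / g1) ((T / (2 * C)) ^ 4) with hκ
  have hκpos : 0 < κ := lt_min (div_pos hg2p hg1p) (by positivity)
  have hκ1 : κ ≤ 1 := (min_le_left _ _).trans ((div_le_one hg1p).2 h21)
  rw [Funnel.criticalTwoPoint_two_mul]
  rcases (show n = 1 ∨ 2 ≤ n by omega) with rfl | hn2
  · -- `n = 1`: `κ g(1) ≤ (g(2)/g(1)) g(1) = g(2)`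
    calc κ * criticalTwoPoint 3 (Pi.single 0 ((1 : ℕ) : ℤ)) ≤ g2 / g1 * g1 :=
          mul_le_mul_of_nonneg_right (min_le_left _ _) hg1p.le
      _ = criticalTwoPoint 3 (Pi.single 0 ((2 * 1 : ℕ) : ℤ)) := by
          rw [div_mul_cancel₀ _ hg1p.ne']
  · by_contra hlt
    push Not at hlt
    have hcore := Funnel.LogConvexSeq.level_lt_of_not_doubling
      (G := fun m : ℕ => criticalTwoPoint 3 (Pi.single 0 (m : ℤ))) hpos hmono henv hκpos hκ1 hn2 hlt
    -- `2 C κ^{1/4} ≤ 2 C (T/2C) = T`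
    have hκ4 : κ ^ ((1 : ℝ) / 4) ≤ T / (2 * C) := by
      have hle : κ ≤ (T / (2 * C)) ^ 4 := min_le_right _ _
      calc κ ^ ((1 : ℝ) / 4) ≤ ((T / (2 * C)) ^ 4) ^ ((1 : ℝ) / 4) :=
            Real.rpow_le_rpow hκpos.le hle (by norm_num)
        _ = T / (2 * C) := by
            rw [one_div, show ((T / (2 * C)) ^ 4 : ℝ) = (T / (2 * C)) ^ ((4 : ℕ) : ℝ) by
              rw [Real.rpow_natCast]]
            rw [← Real.rpow_mul hTC.le]
            norm_num
    have : 2 * C * κ ^ ((1 : ℝ) / 4) ≤ T := by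
      calc 2 * C * κ ^ ((1 : ℝ) / 4) ≤ 2 * C * (T / (2 * C)) :=
            mul_le_mul_of_nonneg_left hκ4 (by linarith)
        _ = T := by field_simp
    linarith

/-- **Where doubling can fail**: a scale `n ≥ 2` at which `κ`-doubling fails (`0 < κ ≤ 1`) is LIGHT, `n·g(n) < 2C·κ^{1/4}`
(`C` the level envelope of `axis_level_le`). [cite: AizenmanDuminilCopinAnnals2021, arXiv:1912.07973 Remark 5.10 (p. 20)] -/
theorem not_doubling_level_lt : ∃ C : ℝ, 0 < C ∧ ∀ κ : ℝ, 0 < κ → κ ≤ 1 → ∀ n : ℕ, 2 ≤ n →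
      criticalTwoPoint 3 (Pi.single 0 (2 * (n : ℤ))) < κ * criticalTwoPoint 3 (Pi.single 0 (n : ℤ)) →
      (n : ℝ) * criticalTwoPoint 3 (Pi.single 0 (n : ℤ)) < 2 * C * κ ^ ((1 : ℝ) / 4) := by
  obtain ⟨C, hC, henv⟩ := axis_level_le
  refine ⟨C, hC, fun κ hκ hκ1 n hn hfail => ?_⟩
  rw [Funnel.criticalTwoPoint_two_mul] at hfail
  exact Funnel.LogConvexSeq.level_lt_of_not_doubling
    (G := fun m : ℕ => criticalTwoPoint 3 (Pi.single 0 (m : ℤ))) (Funnel.criticalTwoPoint_axis_pos 0)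
    (criticalTwoPoint_axis_ratio_mono 0) henv hκ hκ1 hn hfail

end FoldedCurrentRepulsion

end Summit.CriticalPhenomena.Ising3DConformalLimit.Cruxes.ExistsScaleCovariantLimit

end
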